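import Summits.CriticalPhenomena.PercolationContinuityZ3.Theorems.PercNearOneGluingNoHeavyLowerTailKNGoodGCThreeWorlds
import HarnessLib

/-!
# World expansion of a reliability DIFFERENCE under ANY NUMBER of pendant three-port stars (`NoHeavyLowerTail` cell,
# stmt-CriticalPhenomena-4575; prover `prim-hp-2`, gen 14) — tool file for "GC₃ with `m` stars" (memo MEMO-gen14 §7)

Support file (`--supports stmt-CriticalPhenomena-4575`).  No definitions, no named facts, no sorries.

`KNGoodGC3.twoStars_diff` (gen 12) expands `μ_u(a₁↔b) − μ_u(a₂↔b)` for a graph `u` with TWO pendant stars into `{a₁,a₂,a₃}` over the three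
worlds in which `a₁, a₂` are not glued: `q_d·(core) + q₁₃·(core[13]) + q₂₃·(core[23])`.  Here the same is done for a LIST of pendant stars, by
induction on the list, in "forced-core form": the graph `G(S, Y) := (pairs in S sure; pairs meeting Y killed; else u)`.

* `KNGoodGC3Multi.stepGen` — one pendant star `x` of `u` is still a pendant star of `G(S, Y)` (`S` avoiding `x`, `x ∉ Y`, ports `∉ Y`); expanding it
  (`KNGoodGC3.real_openConn_threePort_mix`) gives the five forced cores `G(S ∪ R, insert x Y)`, `R ∈ {∅, {12}, {13}, {23}, {12,13}}`.
* `KNGoodGC3Multi.multiStar_row` — for a list `xs` of pendant stars: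
  `μ_{G(S,Y)}(a₁ b) − μ_{G(S,Y)}(a₂ b) = q_d·D(S) + q₁₃·D(S ∪ {13}) + q₂₃·D(S ∪ {23})`, `D(S') := μ_{G(S', Y ∪ xs)}(a₁ b) − μ_{G(S', Y ∪ xs)}(a₂ b)`,
  with the m-star world weights `q_d = ∏ α_i`, `q₁₃ = ∏(α_i + X^i₁₃) − ∏ α_i`, `q₂₃ = ∏(α_i + X^i₂₃) − ∏α_i` written as `List.prod`s
  (`α_i` = at most one hair, `X^i₁₃ = x^i₁(1−x^i₂)x^i₃`, …).  The worlds `[12]`, `[123]` drop out (`KNGoodGC3.tie_of_mem`).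
  The row for `(a₁, a₃)` is the same theorem with `a₂, a₃` exchanged.
[cite: KozmaNitzan2024, proof of Thm. 4 (pp. 13–14); Grimmett1999, §1.3 (product measure)]
-/

noncomputable section

namespace Summit.CriticalPhenomena.PercolationContinuityZ3.Theorems

open MeasureTheory Set Literature.Probability.LatticeModels Literature.Probability.Percolation
open scoped Classical BigOperators

variable {n : ℕ}

namespace KNGoodGC3Multi

open KNGoodGC3

/-- **One more pendant star inside a forced/killed core.**  `x` a pendant star of `u` into `{a₁,a₂,a₃}`; `S` a set of sure pairs avoiding `x`;
`Y` a set of killed vertices not containing `x` or a port.  Expanding `x` in `G(S,Y)` gives the five forced cores `G(S ∪ R, insert x Y)`.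
[cite: KozmaNitzan2024, proof of Thm. 4 (pp. 13–14); folklore] -/
theorem stepGen (u : Sym2 (Fin n) → unitInterval) (x z b a₁ a₂ a₃ : Fin n)
    (h12 : a₁ ≠ a₂) (h13 : a₁ ≠ a₃) (h23 : a₂ ≠ a₃) (hxa₁ : x ≠ a₁) (hxa₂ : x ≠ a₂) (hxa₃ : x ≠ a₃)
    (hzx : z ≠ x) (hbx : b ≠ x)
    (hxN : ∀ v : Fin n, v ∉ ({a₁, a₂, a₃} : Finset (Fin n)) → u s(x, v) = 0)
    (S : Finset (Sym2 (Fin n))) (hS : ∀ e ∈ S, x ∉ e) (Y : Finset (Fin n)) (hxY : x ∉ Y)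
    (hYa₁ : a₁ ∉ Y) (hYa₂ : a₂ ∉ Y) (hYa₃ : a₃ ∉ Y) :
    (prodBernoulli (fun f : Sym2 (Fin n) => if f ∈ S then (1 : unitInterval) else if (∃ v ∈ Y, v ∈ f) then 0 else u f)).real
        (openConn z b) =
      ((1 - (u s(x, a₁) : ℝ)) * (1 - (u s(x, a₂) : ℝ)) * (1 - (u s(x, a₃) : ℝ)) +
          (u s(x, a₁) : ℝ) * (1 - (u s(x, a₂) : ℝ)) * (1 - (u s(x, a₃) : ℝ)) +
          (1 - (u s(x, a₁) : ℝ)) * (u s(x, a₂) : ℝ) * (1 - (u s(x, a₃) : ℝ)) +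
          (1 - (u s(x, a₁) : ℝ)) * (1 - (u s(x, a₂) : ℝ)) * (u s(x, a₃) : ℝ)) *
          (prodBernoulli (fun f : Sym2 (Fin n) => if f ∈ S then (1 : unitInterval) else
            if (∃ v ∈ insert x Y, v ∈ f) then 0 else u f)).real (openConn z b) +
      (u s(x, a₁) : ℝ) * (u s(x, a₂) : ℝ) * (1 - (u s(x, a₃) : ℝ)) *
          (prodBernoulli (fun f : Sym2 (Fin n) => if f ∈ S ∪ {s(a₁, a₂)} then (1 : unitInterval) else
            if (∃ v ∈ insert x Y, v ∈ f) then 0 else u f)).real (openConn z b) +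
      (u s(x, a₁) : ℝ) * (1 - (u s(x, a₂) : ℝ)) * (u s(x, a₃) : ℝ) *
          (prodBernoulli (fun f : Sym2 (Fin n) => if f ∈ S ∪ {s(a₁, a₃)} then (1 : unitInterval) else
            if (∃ v ∈ insert x Y, v ∈ f) then 0 else u f)).real (openConn z b) +
      (1 - (u s(x, a₁) : ℝ)) * (u s(x, a₂) : ℝ) * (u s(x, a₃) : ℝ) *
          (prodBernoulli (fun f : Sym2 (Fin n) => if f ∈ S ∪ {s(a₂, a₃)} then (1 : unitInterval) else
            if (∃ v ∈ insert x Y, v ∈ f) then 0 else u f)).real (openConn z b) +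
      (u s(x, a₁) : ℝ) * (u s(x, a₂) : ℝ) * (u s(x, a₃) : ℝ) *
          (prodBernoulli (fun f : Sym2 (Fin n) => if f ∈ S ∪ {s(a₁, a₂), s(a₁, a₃)} then (1 : unitInterval) else
            if (∃ v ∈ insert x Y, v ∈ f) then 0 else u f)).real (openConn z b) := by
  set W : Sym2 (Fin n) → unitInterval := fun f => if f ∈ S then (1 : unitInterval) else if (∃ v ∈ Y, v ∈ f) then 0 else u f
    with hW
  have hYx : ∀ a : Fin n, a ∉ Y → ¬ ∃ v ∈ Y, v ∈ s(x, a) := by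
    rintro a ha ⟨v, hv, hvm⟩
    rcases Sym2.mem_iff.1 hvm with rfl | rfl
    · exact hxY hv
    · exact ha hv
  have hWx : ∀ a : Fin n, a ∉ Y → W s(x, a) = u s(x, a) := by
    intro a ha
    have h1 : s(x, a) ∉ S := fun h' => hS _ h' (Sym2.mem_mk_left x a)
    simp only [hW, h1, if_false, hYx a ha]
  have hiso : ∀ v : Fin n, v ≠ x → v ∉ ({a₁, a₂, a₃} : Finset (Fin n)) → W s(x, v) = 0 := by
    intro v _ hv
    have h1 : s(x, v) ∉ S := fun h' => hS _ h' (Sym2.mem_mk_left x v)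
    by_cases hyv : ∃ w ∈ Y, w ∈ s(x, v)
    · simp only [hW, h1, if_false, hyv, if_true]
    · simp only [hW, h1, hyv, if_false]; exact hxN v hv
  have hloop : W s(x, x) = 0 := by
    have h1 : s(x, x) ∉ S := fun h' => hS _ h' (Sym2.mem_mk_left x x)
    simp only [hW, h1, if_false, hYx x hxY]
    exact hxN x (by simp [hxa₁, hxa₂, hxa₃])
  have h := real_openConn_threePort_mix W x z b a₁ a₂ a₃ h12 h13 h23 hxa₁ hxa₂ hxa₃ hzx hbx hiso hloop _ rfl
  rw [hWx a₁ hYa₁, hWx a₂ hYa₂, hWx a₃ hYa₃] at h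
  -- normal forms of the forced cores
  have nT : ∀ T : Finset (Sym2 (Fin n)), (fun f : Sym2 (Fin n) => if f ∈ T then (1 : unitInterval) else
      (fun e : Sym2 (Fin n) => if x ∈ e then (0 : unitInterval) else W e) f) =
      fun f => if f ∈ S ∪ T then (1 : unitInterval) else if (∃ v ∈ insert x Y, v ∈ f) then 0 else u f := by
    intro T; funext f
    simp only [hW, Finset.mem_union]
    by_cases hT : f ∈ T
    · simp [hT]
    · by_cases hfS : f ∈ S
      · have hx : x ∉ f := hS f hfS
        simp [hT, hfS, hx]
      · by_cases hxf : x ∈ f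
        · simp [hT, hfS, hxf]
        · simp [hT, hfS, hxf]
  have n0 : (fun e : Sym2 (Fin n) => if x ∈ e then (0 : unitInterval) else W e) =
      fun f => if f ∈ S then (1 : unitInterval) else if (∃ v ∈ insert x Y, v ∈ f) then 0 else u f := by
    have := nT ∅; simp only [Finset.notMem_empty, if_false, Finset.union_empty] at this; exact this
  rw [n0, nT, nT, nT, nT] at h
  exact h

/-- Two sure pairs through `a₃` tie `a₁` and `a₂`. [folklore] -/
theorem tie_of_path (g : Sym2 (Fin n) → unitInterval) (S : Finset (Sym2 (Fin n))) {a₁ a₂ a₃ : Fin n} (h13 : a₁ ≠ a₃) (h23 : a₂ ≠ a₃)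
    (hm1 : s(a₁, a₃) ∈ S) (hm2 : s(a₂, a₃) ∈ S) (b : Fin n) :
    (prodBernoulli (fun f : Sym2 (Fin n) => if f ∈ S then (1 : unitInterval) else g f)).real (openConn a₁ b) =
      (prodBernoulli (fun f : Sym2 (Fin n) => if f ∈ S then (1 : unitInterval) else g f)).real (openConn a₂ b) := by
  rw [tie_of_mem g S h13 hm1 b, ← tie_of_mem g S h23 hm2 b]

/-- **The loneliness row under a list of pendant stars, world form.**  `xs` a duplicate-free list of pendant stars of `u` into `{a₁,a₂,a₃}`
(no other positive pairs, no loops), `S` sure pairs avoiding the stars, `Y` killed vertices avoiding stars and ports.  Then, with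
`Y' = Y ∪ xs` and `D(S') = μ_{G(S',Y')}(a₁ b) − μ_{G(S',Y')}(a₂ b)`:
`μ_{G(S,Y)}(a₁ b) − μ_{G(S,Y)}(a₂ b) = (∏α)·D(S) + (∏(α+X₁₃) − ∏α)·D(S ∪ {13}) + (∏(α+X₂₃) − ∏α)·D(S ∪ {23})`.
[cite: KozmaNitzan2024, proof of Thm. 4 (pp. 13–14); folklore] -/
theorem multiStar_row (u : Sym2 (Fin n) → unitInterval) (b a₁ a₂ a₃ : Fin n)
    (h12 : a₁ ≠ a₂) (h13 : a₁ ≠ a₃) (h23 : a₂ ≠ a₃)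
    (xs : List (Fin n)) (hnd : xs.Nodup)
    (hxs : ∀ x ∈ xs, x ≠ a₁ ∧ x ≠ a₂ ∧ x ≠ a₃ ∧ b ≠ x ∧ ∀ v : Fin n, v ∉ ({a₁, a₂, a₃} : Finset (Fin n)) → u s(x, v) = 0)
    (S : Finset (Sym2 (Fin n))) (hS : ∀ e ∈ S, ∀ x ∈ xs, x ∉ e)
    (Y : Finset (Fin n)) (hY : ∀ x ∈ xs, x ∉ Y) (hYa₁ : a₁ ∉ Y) (hYa₂ : a₂ ∉ Y) (hYa₃ : a₃ ∉ Y) :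
    (prodBernoulli (fun f : Sym2 (Fin n) => if f ∈ S then (1 : unitInterval) else if (∃ v ∈ Y, v ∈ f) then 0 else u f)).real
        (openConn a₁ b) -
      (prodBernoulli (fun f : Sym2 (Fin n) => if f ∈ S then (1 : unitInterval) else if (∃ v ∈ Y, v ∈ f) then 0 else u f)).real
        (openConn a₂ b) =
      (xs.map (fun x => (1 - (u s(x, a₁) : ℝ)) * (1 - (u s(x, a₂) : ℝ)) * (1 - (u s(x, a₃) : ℝ)) +
          (u s(x, a₁) : ℝ) * (1 - (u s(x, a₂) : ℝ)) * (1 - (u s(x, a₃) : ℝ)) +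
          (1 - (u s(x, a₁) : ℝ)) * (u s(x, a₂) : ℝ) * (1 - (u s(x, a₃) : ℝ)) +
          (1 - (u s(x, a₁) : ℝ)) * (1 - (u s(x, a₂) : ℝ)) * (u s(x, a₃) : ℝ))).prod *
        ((prodBernoulli (fun f : Sym2 (Fin n) => if f ∈ S then (1 : unitInterval) else
            if (∃ v ∈ Y ∪ xs.toFinset, v ∈ f) then 0 else u f)).real (openConn a₁ b) -
          (prodBernoulli (fun f : Sym2 (Fin n) => if f ∈ S then (1 : unitInterval) else
            if (∃ v ∈ Y ∪ xs.toFinset, v ∈ f) then 0 else u f)).real (openConn a₂ b)) +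
      ((xs.map (fun x => (1 - (u s(x, a₁) : ℝ)) * (1 - (u s(x, a₂) : ℝ)) * (1 - (u s(x, a₃) : ℝ)) +
          (u s(x, a₁) : ℝ) * (1 - (u s(x, a₂) : ℝ)) * (1 - (u s(x, a₃) : ℝ)) +
          (1 - (u s(x, a₁) : ℝ)) * (u s(x, a₂) : ℝ) * (1 - (u s(x, a₃) : ℝ)) +
          (1 - (u s(x, a₁) : ℝ)) * (1 - (u s(x, a₂) : ℝ)) * (u s(x, a₃) : ℝ) +
          (u s(x, a₁) : ℝ) * (1 - (u s(x, a₂) : ℝ)) * (u s(x, a₃) : ℝ))).prod -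
        (xs.map (fun x => (1 - (u s(x, a₁) : ℝ)) * (1 - (u s(x, a₂) : ℝ)) * (1 - (u s(x, a₃) : ℝ)) +
          (u s(x, a₁) : ℝ) * (1 - (u s(x, a₂) : ℝ)) * (1 - (u s(x, a₃) : ℝ)) +
          (1 - (u s(x, a₁) : ℝ)) * (u s(x, a₂) : ℝ) * (1 - (u s(x, a₃) : ℝ)) +
          (1 - (u s(x, a₁) : ℝ)) * (1 - (u s(x, a₂) : ℝ)) * (u s(x, a₃) : ℝ))).prod) *
        ((prodBernoulli (fun f : Sym2 (Fin n) => if f ∈ S ∪ {s(a₁, a₃)} then (1 : unitInterval) else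
            if (∃ v ∈ Y ∪ xs.toFinset, v ∈ f) then 0 else u f)).real (openConn a₁ b) -
          (prodBernoulli (fun f : Sym2 (Fin n) => if f ∈ S ∪ {s(a₁, a₃)} then (1 : unitInterval) else
            if (∃ v ∈ Y ∪ xs.toFinset, v ∈ f) then 0 else u f)).real (openConn a₂ b)) +
      ((xs.map (fun x => (1 - (u s(x, a₁) : ℝ)) * (1 - (u s(x, a₂) : ℝ)) * (1 - (u s(x, a₃) : ℝ)) +
          (u s(x, a₁) : ℝ) * (1 - (u s(x, a₂) : ℝ)) * (1 - (u s(x, a₃) : ℝ)) +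
          (1 - (u s(x, a₁) : ℝ)) * (u s(x, a₂) : ℝ) * (1 - (u s(x, a₃) : ℝ)) +
          (1 - (u s(x, a₁) : ℝ)) * (1 - (u s(x, a₂) : ℝ)) * (u s(x, a₃) : ℝ) +
          (1 - (u s(x, a₁) : ℝ)) * (u s(x, a₂) : ℝ) * (u s(x, a₃) : ℝ))).prod -
        (xs.map (fun x => (1 - (u s(x, a₁) : ℝ)) * (1 - (u s(x, a₂) : ℝ)) * (1 - (u s(x, a₃) : ℝ)) +
          (u s(x, a₁) : ℝ) * (1 - (u s(x, a₂) : ℝ)) * (1 - (u s(x, a₃) : ℝ)) +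
          (1 - (u s(x, a₁) : ℝ)) * (u s(x, a₂) : ℝ) * (1 - (u s(x, a₃) : ℝ)) +
          (1 - (u s(x, a₁) : ℝ)) * (1 - (u s(x, a₂) : ℝ)) * (u s(x, a₃) : ℝ))).prod) *
        ((prodBernoulli (fun f : Sym2 (Fin n) => if f ∈ S ∪ {s(a₂, a₃)} then (1 : unitInterval) else
            if (∃ v ∈ Y ∪ xs.toFinset, v ∈ f) then 0 else u f)).real (openConn a₁ b) -
          (prodBernoulli (fun f : Sym2 (Fin n) => if f ∈ S ∪ {s(a₂, a₃)} then (1 : unitInterval) else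
            if (∃ v ∈ Y ∪ xs.toFinset, v ∈ f) then 0 else u f)).real (openConn a₂ b)) := by
  induction xs generalizing S Y with
  | nil =>
    simp only [List.map_nil, List.prod_nil, List.toFinset_nil, Finset.union_empty]
    ring
  | cons x xs ih =>
    obtain ⟨hxa₁, hxa₂, hxa₃, hbx, hxN⟩ := hxs x (List.mem_cons_self)
    have hxs' : ∀ x' ∈ xs, x' ≠ a₁ ∧ x' ≠ a₂ ∧ x' ≠ a₃ ∧ b ≠ x' ∧ ∀ v : Fin n, v ∉ ({a₁, a₂, a₃} : Finset (Fin n)) → u s(x', v) = 0 :=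
      fun x' hx' => hxs x' (List.mem_cons_of_mem x hx')
    have hnd' : xs.Nodup := (List.nodup_cons.1 hnd).2
    have hxxs : x ∉ xs := (List.nodup_cons.1 hnd).1
    have hSx : ∀ e ∈ S, x ∉ e := fun e he => hS e he x (List.mem_cons_self)
    have hxY : x ∉ Y := hY x (List.mem_cons_self)
    -- expand the first star, for `a₁` and for `a₂`
    have E1 := stepGen u x a₁ b a₁ a₂ a₃ h12 h13 h23 hxa₁ hxa₂ hxa₃ (fun h => hxa₁ h.symm) hbx hxN S hSx Y hxY hYa₁ hYa₂ hYa₃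
    have E2 := stepGen u x a₂ b a₁ a₂ a₃ h12 h13 h23 hxa₁ hxa₂ hxa₃ (fun h => hxa₂ h.symm) hbx hxN S hSx Y hxY hYa₁ hYa₂ hYa₃
    rw [E1, E2]
    -- the induction hypothesis in the three surviving worlds
    have hY' : ∀ x' ∈ xs, x' ∉ insert x Y := by
      intro x' hx' h
      rcases Finset.mem_insert.1 h with h | h
      · exact hxxs (h ▸ hx')
      · exact hY x' (List.mem_cons_of_mem x hx') h
    have hYa₁' : a₁ ∉ insert x Y := by
      rw [Finset.mem_insert, not_or]; exact ⟨fun h => hxa₁ h.symm, hYa₁⟩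
    have hYa₂' : a₂ ∉ insert x Y := by
      rw [Finset.mem_insert, not_or]; exact ⟨fun h => hxa₂ h.symm, hYa₂⟩
    have hYa₃' : a₃ ∉ insert x Y := by
      rw [Finset.mem_insert, not_or]; exact ⟨fun h => hxa₃ h.symm, hYa₃⟩
    have relayPair_avoid : ∀ c d : Fin n, (c = a₁ ∨ c = a₂ ∨ c = a₃) → (d = a₁ ∨ d = a₂ ∨ d = a₃) →
        ∀ x' ∈ xs, x' ∉ s(c, d) := by
      intro c d hc hd x' hx' hm
      obtain ⟨h1, h2, h3, -, -⟩ := hxs' x' hx'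
      rcases Sym2.mem_iff.1 hm with rfl | rfl
      · rcases hc with h | h | h
        · exact h1 h
        · exact h2 h
        · exact h3 h
      · rcases hd with h | h | h
        · exact h1 h
        · exact h2 h
        · exact h3 h
    have hS0 : ∀ e ∈ S, ∀ x' ∈ xs, x' ∉ e := fun e he x' hx' => hS e he x' (List.mem_cons_of_mem x hx')
    have hSR : ∀ (c d : Fin n), (c = a₁ ∨ c = a₂ ∨ c = a₃) → (d = a₁ ∨ d = a₂ ∨ d = a₃) →
        ∀ e ∈ S ∪ {s(c, d)}, ∀ x' ∈ xs, x' ∉ e := by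
      intro c d hc hd e he x' hx'
      rcases Finset.mem_union.1 he with he | he
      · exact hS0 e he x' hx'
      · rw [Finset.mem_singleton] at he; subst he; exact relayPair_avoid c d hc hd x' hx'
    have I0 := ih hnd' hxs' S hS0 (insert x Y) hY' hYa₁' hYa₂' hYa₃'
    have I13 := ih hnd' hxs' (S ∪ {s(a₁, a₃)}) (hSR a₁ a₃ (Or.inl rfl) (Or.inr (Or.inr rfl))) (insert x Y) hY' hYa₁' hYa₂' hYa₃'
    have I23 := ih hnd' hxs' (S ∪ {s(a₂, a₃)}) (hSR a₂ a₃ (Or.inr (Or.inl rfl)) (Or.inr (Or.inr rfl))) (insert x Y) hY' hYa₁' hYa₂' hYa₃'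
    -- Finset normal forms
    have hYY : insert x Y ∪ xs.toFinset = Y ∪ (x :: xs).toFinset := by
      rw [List.toFinset_cons, Finset.insert_union, Finset.union_insert]
    have u13 : S ∪ {s(a₁, a₃)} ∪ {s(a₁, a₃)} = S ∪ {s(a₁, a₃)} := by rw [Finset.union_assoc, Finset.union_idempotent]
    have u23 : S ∪ {s(a₂, a₃)} ∪ {s(a₂, a₃)} = S ∪ {s(a₂, a₃)} := by rw [Finset.union_assoc, Finset.union_idempotent]
    rw [hYY] at I0 I13 I23
    rw [u13] at I13
    rw [u23] at I23
    -- ties: worlds in which `a₁ ~ a₂`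
    have t12 : (prodBernoulli (fun f : Sym2 (Fin n) => if f ∈ S ∪ {s(a₁, a₂)} then (1 : unitInterval) else
          if (∃ v ∈ insert x Y, v ∈ f) then 0 else u f)).real (openConn a₁ b) =
        (prodBernoulli (fun f : Sym2 (Fin n) => if f ∈ S ∪ {s(a₁, a₂)} then (1 : unitInterval) else
          if (∃ v ∈ insert x Y, v ∈ f) then 0 else u f)).real (openConn a₂ b) :=
      tie_of_mem (fun f : Sym2 (Fin n) => if (∃ v ∈ insert x Y, v ∈ f) then (0 : unitInterval) else u f) _ h12 (by simp) b
    have t1213 : (prodBernoulli (fun f : Sym2 (Fin n) => if f ∈ S ∪ {s(a₁, a₂), s(a₁, a₃)} then (1 : unitInterval) else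
          if (∃ v ∈ insert x Y, v ∈ f) then 0 else u f)).real (openConn a₁ b) =
        (prodBernoulli (fun f : Sym2 (Fin n) => if f ∈ S ∪ {s(a₁, a₂), s(a₁, a₃)} then (1 : unitInterval) else
          if (∃ v ∈ insert x Y, v ∈ f) then 0 else u f)).real (openConn a₂ b) :=
      tie_of_mem (fun f : Sym2 (Fin n) => if (∃ v ∈ insert x Y, v ∈ f) then (0 : unitInterval) else u f) _ h12 (by simp) b
    have t1323 : (prodBernoulli (fun f : Sym2 (Fin n) => if f ∈ S ∪ {s(a₁, a₃)} ∪ {s(a₂, a₃)} then (1 : unitInterval) else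
          if (∃ v ∈ Y ∪ (x :: xs).toFinset, v ∈ f) then 0 else u f)).real (openConn a₁ b) =
        (prodBernoulli (fun f : Sym2 (Fin n) => if f ∈ S ∪ {s(a₁, a₃)} ∪ {s(a₂, a₃)} then (1 : unitInterval) else
          if (∃ v ∈ Y ∪ (x :: xs).toFinset, v ∈ f) then 0 else u f)).real (openConn a₂ b) :=
      tie_of_path (fun f : Sym2 (Fin n) => if (∃ v ∈ Y ∪ (x :: xs).toFinset, v ∈ f) then (0 : unitInterval) else u f) _ h13 h23
        (by simp) (by simp) b
    have t2313 : (prodBernoulli (fun f : Sym2 (Fin n) => if f ∈ S ∪ {s(a₂, a₃)} ∪ {s(a₁, a₃)} then (1 : unitInterval) else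
          if (∃ v ∈ Y ∪ (x :: xs).toFinset, v ∈ f) then 0 else u f)).real (openConn a₁ b) =
        (prodBernoulli (fun f : Sym2 (Fin n) => if f ∈ S ∪ {s(a₂, a₃)} ∪ {s(a₁, a₃)} then (1 : unitInterval) else
          if (∃ v ∈ Y ∪ (x :: xs).toFinset, v ∈ f) then 0 else u f)).real (openConn a₂ b) :=
      tie_of_path (fun f : Sym2 (Fin n) => if (∃ v ∈ Y ∪ (x :: xs).toFinset, v ∈ f) then (0 : unitInterval) else u f) _ h13 h23
        (by simp) (by simp) b
    simp only [List.map_cons, List.prod_cons]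
    linear_combination ((1 - (u s(x, a₁) : ℝ)) * (1 - (u s(x, a₂) : ℝ)) * (1 - (u s(x, a₃) : ℝ)) +
          (u s(x, a₁) : ℝ) * (1 - (u s(x, a₂) : ℝ)) * (1 - (u s(x, a₃) : ℝ)) +
          (1 - (u s(x, a₁) : ℝ)) * (u s(x, a₂) : ℝ) * (1 - (u s(x, a₃) : ℝ)) +
          (1 - (u s(x, a₁) : ℝ)) * (1 - (u s(x, a₂) : ℝ)) * (u s(x, a₃) : ℝ)) * I0 +
      (u s(x, a₁) : ℝ) * (1 - (u s(x, a₂) : ℝ)) * (u s(x, a₃) : ℝ) * I13 +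
      (1 - (u s(x, a₁) : ℝ)) * (u s(x, a₂) : ℝ) * (u s(x, a₃) : ℝ) * I23 +
      (u s(x, a₁) : ℝ) * (u s(x, a₂) : ℝ) * (1 - (u s(x, a₃) : ℝ)) * t12 +
      (u s(x, a₁) : ℝ) * (u s(x, a₂) : ℝ) * (u s(x, a₃) : ℝ) * t1213 +
      (u s(x, a₁) : ℝ) * (1 - (u s(x, a₂) : ℝ)) * (u s(x, a₃) : ℝ) *
        ((xs.map (fun x => (1 - (u s(x, a₁) : ℝ)) * (1 - (u s(x, a₂) : ℝ)) * (1 - (u s(x, a₃) : ℝ)) +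
          (u s(x, a₁) : ℝ) * (1 - (u s(x, a₂) : ℝ)) * (1 - (u s(x, a₃) : ℝ)) +
          (1 - (u s(x, a₁) : ℝ)) * (u s(x, a₂) : ℝ) * (1 - (u s(x, a₃) : ℝ)) +
          (1 - (u s(x, a₁) : ℝ)) * (1 - (u s(x, a₂) : ℝ)) * (u s(x, a₃) : ℝ) +
          (1 - (u s(x, a₁) : ℝ)) * (u s(x, a₂) : ℝ) * (u s(x, a₃) : ℝ))).prod -
        (xs.map (fun x => (1 - (u s(x, a₁) : ℝ)) * (1 - (u s(x, a₂) : ℝ)) * (1 - (u s(x, a₃) : ℝ)) +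
          (u s(x, a₁) : ℝ) * (1 - (u s(x, a₂) : ℝ)) * (1 - (u s(x, a₃) : ℝ)) +
          (1 - (u s(x, a₁) : ℝ)) * (u s(x, a₂) : ℝ) * (1 - (u s(x, a₃) : ℝ)) +
          (1 - (u s(x, a₁) : ℝ)) * (1 - (u s(x, a₂) : ℝ)) * (u s(x, a₃) : ℝ))).prod) * t1323 +
      (1 - (u s(x, a₁) : ℝ)) * (u s(x, a₂) : ℝ) * (u s(x, a₃) : ℝ) *
        ((xs.map (fun x => (1 - (u s(x, a₁) : ℝ)) * (1 - (u s(x, a₂) : ℝ)) * (1 - (u s(x, a₃) : ℝ)) +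
          (u s(x, a₁) : ℝ) * (1 - (u s(x, a₂) : ℝ)) * (1 - (u s(x, a₃) : ℝ)) +
          (1 - (u s(x, a₁) : ℝ)) * (u s(x, a₂) : ℝ) * (1 - (u s(x, a₃) : ℝ)) +
          (1 - (u s(x, a₁) : ℝ)) * (1 - (u s(x, a₂) : ℝ)) * (u s(x, a₃) : ℝ) +
          (u s(x, a₁) : ℝ) * (1 - (u s(x, a₂) : ℝ)) * (u s(x, a₃) : ℝ))).prod -
        (xs.map (fun x => (1 - (u s(x, a₁) : ℝ)) * (1 - (u s(x, a₂) : ℝ)) * (1 - (u s(x, a₃) : ℝ)) +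
          (u s(x, a₁) : ℝ) * (1 - (u s(x, a₂) : ℝ)) * (1 - (u s(x, a₃) : ℝ)) +
          (1 - (u s(x, a₁) : ℝ)) * (u s(x, a₂) : ℝ) * (1 - (u s(x, a₃) : ℝ)) +
          (1 - (u s(x, a₁) : ℝ)) * (1 - (u s(x, a₂) : ℝ)) * (u s(x, a₃) : ℝ))).prod) * t2313

end KNGoodGC3Multi

end Summit.CriticalPhenomena.PercolationContinuityZ3.Theorems
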